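import Summits.BirchSwinnertonDyer.BirchSwinnertonDyer.Theorems.AdditiveKolyvaginRoadLagrangianSwitchAtPJump
import HarnessLib

/-!
# Route `AdditiveKolyvaginRoad`, crux `LevelKolyvaginSystemsAdditive` (item stmt-BirchSwinnertonDyer-21396, KS′):
# the one-place Lagrangian switch at `p`, part 2 — TWO ISOTROPIC LINES, the LOCAL PAIRING at one place (symmetry, Poitou–Tate
# reciprocity for the relaxed image), Selmer groups of `𝓚[v₀ ↦ D]` — (T-A1p) of `SOCKETS-TRANSFER.md`
# (cell `pub/bsd-wall`, width seat `bsd-wall-akr-p2x-w2` g3; `--supports stmt-BirchSwinnertonDyer-21396`, helper; sequel of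
# `…LagrangianSwitchAtPJump.lean`, p596759; consumed by `…LagrangianSwitchAtP.lean`)

WHY. See the jump file: the transfer-type lines on KS′ (TRIAGE-r1 survivor A) decide their stub (A1) «E's Kummer line at `p` =
the transported Kummer line of the congruent lender» by a ONE-PLACE LAGRANGIAN SWITCH over `ℚ`; w3 g0's `…LagrangianSwitch.lean`
is its linear algebra, and the Poitou–Tate inputs AT THE PLACE `p` were «(T-A1p), not built» (`SOCKETS-TRANSFER.md`,
`ESIDE-CLOSED.md` §2). This part supplies the local half in the tree's Selmer-structure currency, for ANY number field.

WHAT (namespace `…Theorems.AdditiveKoly.LagrangianSwitchAtP`; `W` an elliptic curve over a number field `K`).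
* §1 `eq_or_eq_of_isotropic_of_card_eq` — pure group theory: in a group of order `q²` (`q` an odd prime) with a symmetric
  `ℤ/q`-valued bi-additive pairing of trivial kernel, two DISTINCT isotropic subgroups of order `q` carry every isotropic subgroup
  of order `q` (`H = ℤk ⊕ ℤl`, `b(ik + jl, ik + jl) = 2ij·b(k, l)`, `b(k, l) ≠ 0`) — the additive-group form of w3 g0's
  `LagrangianSwitch.mem_span_or_mem_span_of_isotropic`; with `zmultiples_eq_of_card_eq_prime`, `exists_ne_zero_of_card_eq_prime`.
* §2 `invWeilPairing_symm` — the local cup-product pairing `inv_v(· ∪ₑ ·)` on `H¹(K_v, E[n])` is SYMMETRIC for any curve over `K`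
  (graded commutativity for the skew Weil pairing; akr-p2x g0's `invWeilPairing_comm` was stated for base changes from `ℚ`);
  `invWeilPairing_localization_eq_zero_of_mem_relaxed` — POITOU–TATE RECIPROCITY AT ONE PLACE: for two global classes with E's
  Kummer condition at every place `≠ v₀`, `inv_{v₀}(loc x ∪ₑ loc y) = 0` (all other local terms vanish by the isotropy of the
  Kummer conditions; `sum_inv_weilCupProduct_localization_eq_zero`), i.e. the image at `v₀` of the `v₀`-relaxed Selmer group is
  ISOTROPIC; `selmerGroup_update_eq`, `selmerGroup_kummerStrict_eq` — the Selmer groups of `𝓚[v₀ ↦ D]` and of the strict structure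
  are the relaxed group cut by `loc_{v₀}⁻¹ D` resp. `ker loc_{v₀}`.
* §3 bookkeeping: `natCard_map_eq_relIndex` (`#f(G) = [G : G ∩ ker f]`), `inf_comap_eq_self_of_map_eq`,
  `inf_comap_eq_inf_ker_of_map_eq` (cutting by a line containing, resp. meeting trivially, the image).

HONEST FRAMING: theorems only; 0 definitions, 0 named facts, 0 `sorry`; hypotheses displayed (a Weil pairing `e`, a family
`inv` with `SumLocalTermEqZero` where used); E-side glue; closes nothing. BSD is not proved by any of this.

References: [cite: PoonenRains2012, Prop. 4.10, Prop. 4.11] [cite: MilneADT2006, Ch. I, Cor. 2.3, Thm. 4.10(b), Lemma 6.15]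
[cite: NeukirchSchmidtWingberg2008, I §4 Prop. 1.4.4].
-/

-- single-conjunct summit: `Summit.BirchSwinnertonDyer.BirchSwinnertonDyer.…` repeats the name by design
set_option linter.dupNamespace false

noncomputable section

open scoped Classical NumberField
open Function NumberField IsDedekindDomain Field WeierstrassCurve
open Literature.NumberTheory.EllipticCurves
open Literature.NumberTheory.GaloisRepresentations Literature.NumberTheory.GaloisRepresentations.DiscreteGaloisModule
  Literature.NumberTheory.GaloisCohomology
open Summit.BirchSwinnertonDyer.Rank1Residual.X11b.FiniteDuality
open Summit.BirchSwinnertonDyer.Rank1Residual.X11b.Relaxation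
open Summit.BirchSwinnertonDyer.Rank1Residual.X11b.LocBridge
open Summit.BirchSwinnertonDyer.Rank1Residual.X11b
open Summit.BirchSwinnertonDyer.Rank1Residual.GaloisImage
open Summit.BirchSwinnertonDyer.Rank1Residual.X11b.Three.Koly.ZhangSupply
open Summit.BirchSwinnertonDyer.Rank1Residual.X11b.KummerPT

namespace Summit.BirchSwinnertonDyer.BirchSwinnertonDyer.Theorems.AdditiveKoly.LagrangianSwitchAtP

variable {K : Type} [Field K] [NumberField K] (W : WeierstrassCurve K) [W.IsElliptic]

/-! ## §1 Two distinct isotropic LINES of a non-degenerate symmetric plane over `𝔽_q` exhaust its isotropic lines -/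

section TwoLines

variable {H : Type*} [AddCommGroup H] {q : ℕ} [hq : Fact q.Prime]

/-- In a group of prime order every non-zero element generates. [folklore] -/
theorem zmultiples_eq_of_card_eq_prime (B : AddSubgroup H) (hB : Nat.card B = q) {k : H} (hk : k ∈ B)
    (hk0 : k ≠ 0) : AddSubgroup.zmultiples k = B := by
  have hqp : q.Prime := hq.out
  have hle : AddSubgroup.zmultiples k ≤ B := (AddSubgroup.zmultiples_le).mpr hk
  haveI : Finite B := Nat.finite_of_card_ne_zero (by rw [hB]; exact hqp.ne_zero)
  have hdvd : Nat.card (AddSubgroup.zmultiples k) ∣ q := hB ▸ AddSubgroup.card_dvd_of_le hle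
  rcases (Nat.dvd_prime hqp).mp hdvd with h1 | hqc
  · exfalso
    haveI : Finite (AddSubgroup.zmultiples k) := Finite.of_injective _ (AddSubgroup.inclusion_injective hle)
    have hsub : (⟨k, AddSubgroup.mem_zmultiples k⟩ : AddSubgroup.zmultiples k) = 0 :=
      Subsingleton.elim (h := (Nat.card_eq_one_iff_unique.mp h1).1) _ _
    exact hk0 (congrArg Subtype.val hsub)
  · exact AddSubgroup.eq_of_le_of_card_ge hle (by rw [hB, hqc])

/-- A subgroup of prime order has a non-zero element. [folklore] -/
theorem exists_ne_zero_of_card_eq_prime (B : AddSubgroup H) (hB : Nat.card B = q) : ∃ k ∈ B, k ≠ 0 := by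
  by_contra! h
  have hbot : B = ⊥ := (AddSubgroup.eq_bot_iff_forall _).mpr h
  rw [hbot, AddSubgroup.card_bot] at hB
  exact hq.out.one_lt.ne hB

/-- **Two distinct isotropic lines of a non-degenerate symmetric plane carry every isotropic line.** `H` of order `q²`
(`q` an odd prime) with a symmetric bi-additive `ℤ/q`-valued pairing `b` whose left kernel is trivial; `B ≠ C` isotropic
subgroups of order `q`. Then every isotropic subgroup `A` of order `q` is `B` or `C`: `H = B ⊕ C = ℤk ⊕ ℤl` with
`β = b(k, l) ≠ 0` (non-degeneracy), and for `a = ik + jl ∈ A`, `0 = b(a, a) = 2ijβ` forces `q ∣ i` or `q ∣ j`, i.e.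
`a ∈ C` or `a ∈ B`. (The additive-group form of w3 g0's `LagrangianSwitch.mem_span_or_mem_span_of_isotropic`.)
[cite: PoonenRains2012, Prop. 4.11] [cite: MilneADT2006, Ch. I, Cor. 2.3] -/
theorem eq_or_eq_of_isotropic_of_card_eq (hq2 : q ≠ 2) (hH : Nat.card H = q ^ 2) (b : H →+ H →+ ZMod q)
    (hsymm : ∀ x y, b x y = b y x) (hnd : ∀ x, (∀ y, b x y = 0) → x = 0)
    {A B C : AddSubgroup H} (hA : Nat.card A = q) (hB : Nat.card B = q) (hC : Nat.card C = q)
    (hAiso : ∀ x ∈ A, ∀ y ∈ A, b x y = 0) (hBiso : ∀ x ∈ B, ∀ y ∈ B, b x y = 0)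
    (hCiso : ∀ x ∈ C, ∀ y ∈ C, b x y = 0) (hBC : B ≠ C) : A = B ∨ A = C := by
  have hqp : q.Prime := hq.out
  haveI : Finite H := Nat.finite_of_card_ne_zero (by rw [hH]; exact pow_ne_zero 2 hqp.ne_zero)
  -- equal prime order: `≤` is `=`, and a common non-zero element forces equality
  have heq_of_le : ∀ {X Y : AddSubgroup H}, Nat.card X = q → Nat.card Y = q → X ≤ Y → X = Y :=
    fun hX hY hle ↦ AddSubgroup.eq_of_le_of_card_ge hle (by rw [hX, hY])
  have heq_of_mem : ∀ {X Y : AddSubgroup H}, Nat.card X = q → Nat.card Y = q →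
      ∀ {x : H}, x ∈ X → x ∈ Y → x ≠ 0 → X = Y := fun hX hY x hxX hxY hx0 ↦ by
    rw [← zmultiples_eq_of_card_eq_prime _ hX hxX hx0, ← zmultiples_eq_of_card_eq_prime _ hY hxY hx0]
  -- generators `k` of `B` and `l ∈ C ∖ B`
  obtain ⟨k, hkB, hk0⟩ := exists_ne_zero_of_card_eq_prime B hB
  obtain ⟨l, hlC, hlB⟩ : ∃ l ∈ C, l ∉ B := by
    by_contra! h
    exact hBC (heq_of_le hC hB h).symm
  have hl0 : l ≠ 0 := fun h ↦ hlB (h ▸ B.zero_mem)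
  have hBk : AddSubgroup.zmultiples k = B := zmultiples_eq_of_card_eq_prime B hB hkB hk0
  have hCl : AddSubgroup.zmultiples l = C := zmultiples_eq_of_card_eq_prime C hC hlC hl0
  -- `B ⊔ C = H`
  have hsup : B ⊔ C = ⊤ := by
    have hne : B ⊔ C ≠ B := fun h ↦ hlB (h ▸ AddSubgroup.mem_sup_right hlC)
    have hdvd : Nat.card (B ⊔ C : AddSubgroup H) ∣ q ^ 2 := hH ▸ AddSubgroup.card_addSubgroup_dvd_card _
    obtain ⟨i, hi, hcard⟩ := (Nat.dvd_prime_pow hqp).mp hdvd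
    have hqdvd : q ∣ Nat.card (B ⊔ C : AddSubgroup H) := hB ▸ AddSubgroup.card_dvd_of_le le_sup_left
    interval_cases i
    · rw [hcard, pow_zero, Nat.dvd_one] at hqdvd
      exact absurd hqdvd hqp.one_lt.ne'
    · exact absurd (heq_of_le hB (by rw [hcard, pow_one]) le_sup_left).symm hne
    · exact AddSubgroup.eq_top_of_card_eq _ (by rw [hcard, hH])
  -- every element is `i • k + j • l`
  have hdecomp : ∀ x : H, ∃ i j : ℤ, i • k + j • l = x := fun x ↦ by
    have hx : x ∈ B ⊔ C := hsup ▸ AddSubgroup.mem_top x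
    obtain ⟨y₁, hy₁, y₂, hy₂, rfl⟩ := AddSubgroup.mem_sup.mp hx
    rw [← hBk] at hy₁
    rw [← hCl] at hy₂
    obtain ⟨i, rfl⟩ := AddSubgroup.mem_zmultiples_iff.mp hy₁
    obtain ⟨j, rfl⟩ := AddSubgroup.mem_zmultiples_iff.mp hy₂
    exact ⟨i, j, rfl⟩
  have hbil : ∀ (i j : ℤ) (x y : H), b (i • x) (j • y) = (j * i) • b x y := fun i j x y ↦ by
    rw [map_zsmul, map_zsmul, AddMonoidHom.zsmul_apply, smul_smul]
  have hkk : b k k = 0 := hBiso k hkB k hkB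
  have hll : b l l = 0 := hCiso l hlC l hlC
  -- non-degeneracy: `β = b(k, l) ≠ 0`
  have hβ : b k l ≠ 0 := by
    intro h0
    refine hk0 (hnd k fun y ↦ ?_)
    obtain ⟨i, j, rfl⟩ := hdecomp y
    have h1 : b k (i • k) = 0 := by
      have := hbil 1 i k k
      rw [one_zsmul] at this
      rw [this, hkk, smul_zero]
    have h2 : b k (j • l) = 0 := by
      have := hbil 1 j k l
      rw [one_zsmul] at this
      rw [this, h0, smul_zero]
    rw [map_add, h1, h2, add_zero]
  -- a non-zero `a ∈ A`, written `a = i • k + j • l`, has `2 i j β = 0`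
  obtain ⟨a, haA, ha0⟩ := exists_ne_zero_of_card_eq_prime A hA
  obtain ⟨i, j, hij⟩ := hdecomp a
  have hiso : b a a = 0 := hAiso a haA a haA
  have hexp : b a a = (2 * i * j) • b k l := by
    have e1 : b (i • k + j • l) = b (i • k) + b (j • l) := map_add b _ _
    rw [← hij, e1, AddMonoidHom.add_apply, map_add, map_add, hbil, hbil, hbil, hbil, hkk, hll, hsymm l k]
    simp only [smul_zero, zero_add, add_zero, ← add_smul]
    congr 1
    ring
  rw [hexp, zsmul_eq_mul] at hiso
  have hcast : ((2 * i * j : ℤ) : ZMod q) = 0 := by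
    rcases mul_eq_zero.mp hiso with h | h
    · exact h
    · exact absurd h hβ
  rw [ZMod.intCast_zmod_eq_zero_iff_dvd] at hcast
  have hq2' : ¬ (q : ℤ) ∣ 2 := fun h ↦ by
    have h' : q ∣ 2 := by exact_mod_cast h
    exact hq2 ((Nat.prime_dvd_prime_iff_eq hqp Nat.prime_two).mp h')
  have hqi : (q : ℤ) ∣ i ∨ (q : ℤ) ∣ j := by
    have hprime : Prime (q : ℤ) := Nat.prime_iff_prime_int.mp hqp
    rcases hprime.dvd_or_dvd hcast with h | h
    · rcases hprime.dvd_or_dvd h with h2 | hi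
      · exact absurd h2 hq2'
      · exact Or.inl hi
    · exact Or.inr h
  -- `q • k = 0`, `q • l = 0`
  have hqk : (q : ℤ) • k = 0 := by
    have := card_nsmul_eq_zero' (x := (⟨k, hkB⟩ : B))
    rw [hB] at this
    rw [natCast_zsmul]
    exact congrArg Subtype.val this
  have hql : (q : ℤ) • l = 0 := by
    have := card_nsmul_eq_zero' (x := (⟨l, hlC⟩ : C))
    rw [hC] at this
    rw [natCast_zsmul]
    exact congrArg Subtype.val this
  rcases hqi with ⟨c, hc⟩ | ⟨c, hc⟩
  · -- `q ∣ i`: `a = j • l ∈ C`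
    right
    have haC : a ∈ C := by
      rw [← hij, hc, mul_comm, mul_zsmul, hqk, smul_zero, zero_add, ← hCl]
      exact AddSubgroup.zsmul_mem_zmultiples l j
    exact heq_of_mem hA hC haA haC ha0
  · -- `q ∣ j`: `a = i • k ∈ B`
    left
    have haB : a ∈ B := by
      rw [← hij, hc, mul_comm, mul_zsmul, hql, smul_zero, add_zero, ← hBk]
      exact AddSubgroup.zsmul_mem_zmultiples k i
    exact heq_of_mem hA hB haA haB ha0

end TwoLines


/-! ## §2 The local pairing at one place: symmetry, isotropy of the relaxed image, the Selmer group of `𝓚[w₀ ↦ D]` -/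

section Local

variable (n : ℕ) [NeZero n]
variable (e : W.geomTorsion n → W.geomTorsion n → AlgebraicClosure K)
  (hμ : ∀ S T, e S T ^ n = 1)
  (hadd₁ : ∀ S₁ S₂ T, e (S₁ + S₂) T = e S₁ T * e S₂ T)
  (hadd₂ : ∀ S T₁ T₂, e S (T₁ + T₂) = e S T₁ * e S T₂)
  (hgal : ∀ (σ : absoluteGaloisGroup K) (S T : W.geomTorsion n), σ • e S T = e (σ • S) (σ • T))
  (halt : ∀ T, e T T = 1) (hnondeg : ∀ T, (∀ S, e S T = 1) → T = 0)
  (inv : LocalInvariants K n)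

omit [W.IsElliptic] in
include halt in
/-- **The local Weil cup-product pairing `inv_v(· ∪ₑ ·)` is SYMMETRIC** at every place (graded commutativity in bidegree
`(1,1)` for the skew Weil pairing; akr-p2x g0's `invWeilPairing_comm` for a general curve over `K`).
[cite: NeukirchSchmidtWingberg2008, I §4 Prop. 1.4.4] -/
theorem invWeilPairing_symm
    -- cup products need the compactness of the local absolute Galois groups (binder, discharged by
    -- `absoluteGaloisGroup_compactSpace` at the call site)
    [∀ v : Place K, CompactSpace (absoluteGaloisGroup (Place.Completion v))]
    (v : Place K) (a b : galoisCohomology ((W.torsionGaloisModule n).toLocal v) 1) :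
    invWeilPairing W n e hμ hadd₁ hadd₂ hgal inv v a b = invWeilPairing W n e hμ hadd₁ hadd₂ hgal inv v b a := by
  rw [invWeilPairing_apply, invWeilPairing_apply]
  congr 1
  refine cupProduct_comm_of_skew _ (fun S T ↦ ?_) a b
  rw [weilContPairingLocal_toLin_apply, weilContPairingLocal_toLin_apply]
  -- an alternating bi-additive pairing is skew (akr-p2x g0's `skew_of_alternating'`, inlined)
  have h := weilPairingHom_self W n e hμ hadd₁ hadd₂ halt (S + T)
  simp only [map_add, AddMonoidHom.add_apply, weilPairingHom_self W n e hμ hadd₁ hadd₂ halt, zero_add, add_zero] at h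
  rw [add_comm] at h
  exact eq_neg_of_add_eq_zero_left h

include halt in
/-- **Poitou–Tate reciprocity at ONE place: the image at `v₀` of the `v₀`-relaxed Selmer group is ISOTROPIC.** For global
classes `x, y` satisfying E's Kummer condition at every place `≠ v₀` (`H¹_{𝓚 relaxed at v₀} = kummerOutside W n {v₀}`),
`inv_{v₀}(loc_{v₀} x ∪ₑ loc_{v₀} y) = 0`: every other local term of the Poitou–Tate sum vanishes by the isotropy of the
Kummer conditions (Poonen–Rains), hence so does the one at `v₀` (`sum_inv_weilCupProduct_localization_eq_zero`).
[cite: MilneADT2006, Ch. I, Thm. 4.10(b)] [cite: PoonenRains2012, Prop. 4.10, Prop. 4.11] -/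
theorem invWeilPairing_localization_eq_zero_of_mem_relaxed
    [∀ v : Place K, CompactSpace (absoluteGaloisGroup (Place.Completion v))] [Finite (W.geomTorsion n)]
    (hPT : inv.SumLocalTermEqZero) (v₀ : Place K)
    {x y : galoisCohomology (W.torsionGaloisModule n) 1} (hx : x ∈ (kummerRelaxed W n {v₀}).selmerGroup)
    (hy : y ∈ (kummerRelaxed W n {v₀}).selmerGroup) :
    invWeilPairing W n e hμ hadd₁ hadd₂ hgal inv v₀
      (galoisCohomology.localization (W.torsionGaloisModule n) v₀ 1 x)
      (galoisCohomology.localization (W.torsionGaloisModule n) v₀ 1 y) = 0 := by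
  rw [SelmerStructure.mem_selmerGroup_iff] at hx hy
  have hS : ∀ v ∉ ({v₀} : Finset (Place K)), inv v ((weilContPairingLocal W n e hμ hadd₁ hadd₂ hgal v).cupProduct
      (galoisCohomology.localization (W.torsionGaloisModule n) v 1 x)
      (galoisCohomology.localization (W.torsionGaloisModule n) v 1 y)) = 0 := by
    intro v hv
    have hxv := hx v
    have hyv := hy v
    rw [kummerRelaxed_of_not_mem W n {v₀} hv] at hxv hyv
    have h := invWeilPairing_eq_zero_of_mem W n e hμ hadd₁ hadd₂ hgal halt inv v hxv hyv
    rwa [invWeilPairing_apply] at h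
  have h := sum_inv_weilCupProduct_localization_eq_zero W n e hμ hadd₁ hadd₂ hgal inv hPT x y {v₀} hS
  rwa [Finset.sum_singleton, ← invWeilPairing_apply] at h

omit [NeZero n] [W.IsElliptic] in
/-- **The Selmer group of `𝓚[v₀ ↦ D]`** (E's Kummer condition everywhere except a chosen condition `D` at `v₀`) is the
`v₀`-relaxed Selmer group cut by `loc_{v₀}⁻¹ D`. [cite: MilneADT2006, Ch. I §6, Lemma 6.15] -/
theorem selmerGroup_update_eq (v₀ : Place K)
    (D : AddSubgroup (galoisCohomology ((W.torsionGaloisModule (n : ℤ)).toLocal v₀) 1)) :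
    SelmerStructure.selmerGroup
        (Function.update (W.kummerSelmerStructure (n : ℤ)) v₀ D : SelmerStructure (W.torsionGaloisModule (n : ℤ))) =
      (kummerRelaxed W n {v₀}).selmerGroup ⊓
        D.comap (galoisCohomology.localization (W.torsionGaloisModule (n : ℤ)) v₀ 1) := by
  ext x
  simp only [AddSubgroup.mem_inf, AddSubgroup.mem_comap, SelmerStructure.mem_selmerGroup_iff]
  constructor
  · intro h
    refine ⟨fun v ↦ ?_, ?_⟩
    · by_cases hv : v ∈ ({v₀} : Finset (Place K))
      · rw [kummerRelaxed_of_mem W n {v₀} hv]; exact AddSubgroup.mem_top _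
      · rw [kummerRelaxed_of_not_mem W n {v₀} hv]
        have hne : v ≠ v₀ := fun h' ↦ hv (h' ▸ Finset.mem_singleton_self _)
        have h' := h v
        rwa [Function.update_of_ne hne] at h'
    · have h' := h v₀
      rwa [Function.update_self] at h'
  · rintro ⟨h, hD⟩ v
    by_cases hv : v = v₀
    · subst hv; rwa [Function.update_self]
    · rw [Function.update_of_ne hv]
      have h' := h v
      rwa [kummerRelaxed_of_not_mem W n {v₀} (fun h'' ↦ hv (Finset.mem_singleton.mp h''))] at h'

omit [NeZero n] [W.IsElliptic] in
/-- The strict group is the relaxed group cut by `ker loc_{v₀}`. [folklore] -/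
theorem selmerGroup_kummerStrict_eq (v₀ : Place K) :
    (kummerStrict W n {v₀}).selmerGroup = (kummerRelaxed W n {v₀}).selmerGroup ⊓
      (galoisCohomology.localization (W.torsionGaloisModule (n : ℤ)) v₀ 1).ker := by
  ext x
  simp only [AddSubgroup.mem_inf, AddMonoidHom.mem_ker, SelmerStructure.mem_selmerGroup_iff]
  constructor
  · intro h
    refine ⟨fun v ↦ kummerStrict_le_kummerRelaxed W n {v₀} v (h v), ?_⟩
    have h' := h v₀
    rw [kummerStrict_of_mem W n {v₀} (Finset.mem_singleton_self _)] at h'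
    exact (AddSubgroup.mem_bot).mp h'
  · rintro ⟨h, h0⟩ v
    by_cases hv : v ∈ ({v₀} : Finset (Place K))
    · rw [kummerStrict_of_mem W n {v₀} hv]
      rw [Finset.mem_singleton] at hv
      subst hv
      exact (AddSubgroup.mem_bot).mpr h0
    · rw [kummerStrict_of_not_mem W n {v₀} hv]
      have h' := h v
      rwa [kummerRelaxed_of_not_mem W n {v₀} hv] at h'

end Local


/-! ## §3 Three pieces of subgroup bookkeeping -/

section Bookkeeping

variable {V H : Type*} [AddCommGroup V] [AddCommGroup H]

/-- `#f(G) = [G : G ∩ ker f]`. [folklore] -/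
theorem natCard_map_eq_relIndex (f : V →+ H) (G : AddSubgroup V) :
    Nat.card (G.map f) = (G ⊓ f.ker).relIndex G := by
  have h1 : (f.comp G.subtype).range = G.map f := by
    rw [← AddMonoidHom.map_range, AddSubgroup.range_subtype]
  have h2 : (f.comp G.subtype).ker = (G ⊓ f.ker).addSubgroupOf G := by
    ext x
    simp only [AddMonoidHom.mem_ker, AddMonoidHom.coe_comp, Function.comp_apply, AddSubgroup.mem_addSubgroupOf,
      AddSubgroup.mem_inf, AddSubgroup.coe_subtype]
    exact ⟨fun h ↦ ⟨x.2, h⟩, fun h ↦ h.2⟩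
  have h3 := AddSubgroup.index_ker (f.comp G.subtype)
  rw [h2, h1] at h3
  exact h3.symm

/-- If `f(G) = D` then cutting `G` by `f⁻¹ D` does nothing. [folklore] -/
theorem inf_comap_eq_self_of_map_eq (f : V →+ H) (G : AddSubgroup V) {D : AddSubgroup H} (hD : G.map f = D) :
    G ⊓ D.comap f = G := by
  refine le_antisymm inf_le_left fun x hx ↦ AddSubgroup.mem_inf.mpr ⟨hx, ?_⟩
  rw [AddSubgroup.mem_comap, ← hD]
  exact AddSubgroup.mem_map_of_mem f hx

/-- If `f(G) = D` and `D ∩ D' = 0` then cutting `G` by `f⁻¹ D'` is cutting by `ker f`. [folklore] -/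
theorem inf_comap_eq_inf_ker_of_map_eq (f : V →+ H) (G : AddSubgroup V) {D D' : AddSubgroup H} (hD : G.map f = D)
    (hDD' : ∀ z, z ∈ D → z ∈ D' → z = 0) : G ⊓ D'.comap f = G ⊓ f.ker := by
  ext x
  simp only [AddSubgroup.mem_inf, AddSubgroup.mem_comap, AddMonoidHom.mem_ker]
  constructor
  · rintro ⟨hx, hxD'⟩
    exact ⟨hx, hDD' _ (hD ▸ AddSubgroup.mem_map_of_mem f hx) hxD'⟩
  · rintro ⟨hx, hx0⟩
    exact ⟨hx, by rw [hx0]; exact D'.zero_mem⟩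

end Bookkeeping

end Summit.BirchSwinnertonDyer.BirchSwinnertonDyer.Theorems.AdditiveKoly.LagrangianSwitchAtP

end
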